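import Summits.ResolutionOfSingularities.ResolutionOfSingularities.Theorems.PurelyInseparableDim4ResConePowerConeTailDiagSigma
import Summits.ResolutionOfSingularities.ResolutionOfSingularities.Theorems.PurelyInseparableDim4ResConePowerConeTailClassIRawSigma
import HarnessLib
import HarnessLib.Audit.Tags

/-!
# Purely inseparable four-folds — POWER-CONE TAILS, THE σ-DIAGONAL FROM THE RAW CHAIN: a T-sector power-cone tail with weights
# (n, n, n) on SOME three letters at every late time is impossible — every prime (cell `res-dim4-pi`, K2(p) lane, B rows, row B-LF
# (iii-b) «K24a-PRIME-σ», the DIAGONAL `w = n`, RAW link; seat res-dim4-p-1 g7)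

[OURS · counted 0 · cell `res-dim4-pi` · K2(p) lane (holder res-dim4-p-12 g5, ruling g5-24 «σ-DIAGONAL = p-1 g7»).  LINK ONLY — the kill is
`ResCone.no_threeLetter_powerCone_tail_diag_sigma` (`…PowerConeTailDiagSigma`: res-dim4-p-7 g6's ledger-free core, res-dim4-typ-1 g5's
transport relabelled, res-dim4-p-1 g6's entry frame, res-dim4-p-5 g6's drift theorem), CITED BY NAME; the chain bookkeeping is the class-(i)
RAW link's (`…PowerConeTailClassIRawSigma`, p723209: `exists_reexc_chain`, `exc_subset_rsupport`, `sigma_mapDomain_perm`).]  Nothing here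
proves K2(p) for any `p`, any TAIL(p, d, 3), `NoAboveFloorTrap p p` or resolution of singularities in dimension ≥ 4 / characteristic `p` —
NOT proved.  AI kernel work, weaker than expert review.

WHAT THIS FILE ADDS.  From the lane's RAW package (an isolated above-floor witnessed `Step0 p` chain with `x^{r₀} ∣ F₀`, shade `d` and
`e_G = 3` from `k₀`, polar kernels `ℓ k`) plus «weights `n·x + n·y + n·v` for SOME three letters at every `k ≥ k₀`» (`2n + d = p`, `d ≥ 2`)
and the T-sector witness «at a late time `kₑ` a weight-0 letter `φ` carries the form»:
* §1 `sigma_diag_of_chain` — along a witnessed chain of order `p + n` whose charts avoid `z`, σ-diagonal weights for SOME three letters at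
  every time sit on the SAME three letters for ever (`step_cases_of_diag_sigma` by induction);
* §2 **`no_powerCone_tail_diag_sigma_raw`** — partner chain of `ResCone.powerCone_freeCarrier_representation` (φ never charted), boundary
  twin (`exists_reexc_chain`, so `φ ∉ exc` costs nothing), §1 letters, a satellite (= letter-change) time `t₀ ≥ 1`
  (`FreeTailProof.noIsolatedFreeTailAt_self`), the power-cone form there (`chain_resForm_eq_C_mul_pow`, `ℓ φ ≠ 0` from the partner's kernel
  clause), shift by `t₀`, `no_threeLetter_powerCone_tail_diag_sigma`.
* §3 **`no_powerCone_tail_sigma_raw`** — with p723209 (class (i), `w ≠ n`): every T-sector σ = (n, n) + w with `w ≥ 1` from the raw package,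
  ONE citation point; `w = 0` (class (iii), two free letters) is res-dim4-typ-1's port and is NOT covered here; nothing here is B-LOSSY.
[cite: CossartJannsenSaito2020, Thm. 3.14] [cite: Hauser2010, §§F–G (transform D′; cleaning)] [cite: HauserPerlega2019PRIMS, §2 (transform D′ of D)]
bears_on: LADDER-RESOLUTION:D157-DOOR2 (res-dim4-pi · K2(p) B-LF (iii-b) K24a-PRIME-σ DIAGONAL RAW link).  Supports
stmt-ResolutionOfSingularities-16155 (helper).
-/

set_option linter.dupNamespace false -- mandated namespace of this single-conjunct summit

noncomputable section

namespace Summit.ResolutionOfSingularities.ResolutionOfSingularities.Theorems.PIDim4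
namespace ResCone

open MvPolynomial Finset
open Literature.AlgebraicGeometry.Resolution
open Literature.AlgebraicGeometry.Resolution.CentreBlowup
open Literature.AlgebraicGeometry.Resolution.Hauser2010
open Literature.AlgebraicGeometry.Resolution.HauserPerlega2019

variable {K : Type} [Field K] [DecidableEq K]

/-! ## §1 σ-diagonal weights sit on fixed letters along a chain avoiding the carrier -/

/-- **Along a witnessed chain whose charts avoid `z`, with order `p + n` and σ-diagonal weights (n, n, n) for SOME three letters at every
time, the weights of time `0` sit on the SAME letters for ever** (`step_cases_of_diag_sigma` by induction). [OURS]
[cite: Hauser2010, §F (transform D′)] -/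
theorem sigma_diag_of_chain (p : ℕ) {n : ℕ} (hn : 0 < n) {x y v z : Fin 4} (hxy : x ≠ y) (hxv : x ≠ v) (hxz : x ≠ z)
    (hyv : y ≠ v) (hyz : y ≠ z) (hvz : v ≠ z) {c : ℕ → State K} {j : ℕ → Fin 4} {b : ℕ → Fin 4 → K}
    (hwit : FreeTail.IsWitnessedChain p c j b) (hjz : ∀ k, j k ≠ z)
    (hr0 : (c 0).r = Finsupp.single x n + Finsupp.single y n + Finsupp.single v n)
    (hσtail : ∀ k, ∃ x' y' v' : Fin 4, x' ≠ y' ∧ x' ≠ v' ∧ y' ≠ v' ∧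
      (c k).r = Finsupp.single x' n + Finsupp.single y' n + Finsupp.single v' n)
    (ho : ∀ k, ordZero (c k).F = ((p + n : ℕ) : ℕ∞)) :
    ∀ k, (c k).r = Finsupp.single x n + Finsupp.single y n + Finsupp.single v n := by
  have hstep : ∀ k, c (k + 1) = CentreBlowup.step p Finset.univ (j k) (b k) (c k) := fun k => (hwit k).2.2.2.2
  have hbj : ∀ k, b k (j k) = 0 := fun k => (hwit k).2.1
  intro k
  induction k with
  | zero => exact hr0
  | succ k ih =>
    obtain ⟨x', y', v', h1, h2, h3, hr'⟩ := hσtail (k + 1)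
    rw [hstep k] at hr' ⊢
    exact (step_cases_of_diag_sigma p hn hxy hxv hxz hyv hyz hvz ih (ho k) (hjz k) (hbj k)
      ⟨x', y', v', h1, h2, h3, hr'⟩).2.trans ih

/-! ## §2 The σ-diagonal from the raw chain -/

/-- **NO T-SECTOR POWER-CONE TAIL WITH σ-DIAGONAL WEIGHTS (n, n, n) — every prime, every `n ≥ 1` with `2n + d = p`, `d ≥ 2`** (module
docstring): the lane's RAW package + σ-diagonal weights for SOME three letters at every late time + a late weight-0 form-carrying letter ⊢
`False`.  LINK: partner of `powerCone_freeCarrier_representation`, boundary twin, fixed letters (§1), a satellite time (free-tail lemma), the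
power-cone form there, `no_threeLetter_powerCone_tail_diag_sigma`. [OURS · link · every mathematical step cited by name]
[cite: CossartJannsenSaito2020, Thm. 3.14] [cite: Hauser2010, §§F–G] [cite: HauserPerlega2019PRIMS, §2 (transform D′ of D)] -/
theorem no_powerCone_tail_diag_sigma_raw (p : ℕ) [Fact p.Prime] [CharP K p] {n d : ℕ} (hσ : n + n + d = p) (hn : 0 < n)
    (hd2 : 2 ≤ d) {c : ℕ → State K} {j : ℕ → Fin 4} {b : ℕ → Fin 4 → K}
    (hc : ∀ k, IsIsolated p (c k).F ∧ Step0 p (c k) (c (k + 1))) (hwit : FreeTail.IsWitnessedChain p c j b)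
    (hr0 : ∀ e ∈ (c 0).F.support, (c 0).r ≤ e) (hfloor : ∀ k, ordZero (c k).F ≠ p) {k₀ : ℕ}
    (hshade : ∀ k, k₀ ≤ k → (c k).shade = (d : ℕ∞)) (he3 : ∀ k, k₀ ≤ k → Module.finrank K (resVertex (c k)) = 3)
    (hσtail : ∀ k, k₀ ≤ k → ∃ x y v : Fin 4, x ≠ y ∧ x ≠ v ∧ y ≠ v ∧
      (c k).r = Finsupp.single x n + Finsupp.single y n + Finsupp.single v n)
    {ℓ : ℕ → Fin 4 → K} (hℓV : ∀ k, k₀ ≤ k → ∀ u, u ∈ resVertex (c k) ↔ dotProduct (ℓ k) u = 0)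
    {kₑ : ℕ} (hke : k₀ + 1 ≤ kₑ) {φ : Fin 4} (hrφ : (c kₑ).r φ = 0) (hℓφ : ℓ kₑ φ ≠ 0) : False := by
  classical
  have hdp : d < p := by omega
  -- (1) the partner: `φ` never charted, weight `0` for ever, carrying the form; weights = permutation images
  obtain ⟨c₁, j₁, b₁, hc₁0, hperm, hrφ₁, hjφ, hker, hc₁, hw₁, hr0₁, hfloor₁, hshade₁, he3₁⟩ :=
    powerCone_freeCarrier_representation p hc hwit hr0 hfloor hshade he3 hℓV hke hrφ hℓφ
  -- (2) the boundary twin of the partner: same `F`, `r`, charts, points; `exc₀ = ∅`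
  obtain ⟨c', hw', hFr, hexc0⟩ := exists_reexc_chain hw₁
  have hF' : ∀ t, (c' t).F = (c₁ t).F := fun t => (hFr t).1
  have hr' : ∀ t, (c' t).r = (c₁ t).r := fun t => (hFr t).2
  have hstep' : ∀ t, c' (t + 1) = CentreBlowup.step p Finset.univ (j₁ t) (b₁ t) (c' t) := fun t => (hw' t).2.2.2.2
  have hiso' : ∀ t, IsIsolated p (c' t).F := fun t => by rw [hF']; exact (hc₁ t).1
  have hc' : ∀ t, IsIsolated p (c' t).F ∧ Step0 p (c' t) (c' (t + 1)) := fun t => by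
    obtain ⟨hq, hbj, heq, hne, hst⟩ := hw' t
    exact ⟨hiso' t, hq, j₁ t, b₁ t, Finset.mem_univ _, hbj, heq, hne, hst⟩
  have hfloor' : ∀ t, ordZero (c' t).F ≠ p := fun t => by rw [hF']; exact hfloor₁ t
  have hshade' : ∀ t, 0 ≤ t → (c' t).shade = (d : ℕ∞) := fun t ht => by
    have h := hshade₁ t ht
    unfold CState.shade at h ⊢
    rw [hF', hr']; exact h
  have hresV' : ∀ t, resVertex (c' t) = resVertex (c₁ t) := fun t => by
    unfold resVertex resForm
    rw [hF', hr']
  have he3' : ∀ t, 0 ≤ t → Module.finrank K (resVertex (c' t)) = 3 := fun t ht => by rw [hresV']; exact he3₁ t ht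
  have hdiv' : ∀ t, ∀ e ∈ (c' t).F.support, (c' t).r ≤ e := by
    intro t
    induction t with
    | zero => rw [hF', hr']; exact hr0₁
    | succ t ih => rw [hstep' t]; exact SwapTransport.forall_le_step_gen (c' t) ih (j₁ t) (hw' t).2.1
  have hband' : ∀ t, ∃ o : ℕ, ordZero (c' t).F = o ∧ p < o := fun t => by
    obtain ⟨o, ho, hpo, -⟩ := chain_band p hc' hfloor' t
    exact ⟨o, ho, hpo⟩
  -- order `p + n` and the values of the weights
  have hdeg : ∀ t, (c' t).r.degree = 2 * n + n := fun t => by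
    obtain ⟨π, hπ⟩ := hperm t
    obtain ⟨a, a', u, h1, h2, h3, hr⟩ := hσtail (kₑ + t) (by omega)
    obtain ⟨x, y, v, -, -, -, hσ'⟩ := sigma_mapDomain_perm h1 h2 h3 π hr
    rw [hr', hπ, hσ', map_add, map_add, Finsupp.degree_single, Finsupp.degree_single, Finsupp.degree_single]
    omega
  have ho' : ∀ t, ordZero (c' t).F = ((p + n : ℕ) : ℕ∞) := fun t => by
    obtain ⟨o, ho, hpo⟩ := hband' t
    have hsh := hshade' t (Nat.zero_le _)
    rw [BandShade.shade_eq_coe ho, hdeg, Nat.cast_inj] at hsh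
    rw [ho]; congr 1; omega
  -- (3) `φ` is never exceptional on the twin
  have hexc : ∀ t, ∀ i ∈ (c' t).exc, (c' t).r i ≠ 0 :=
    exc_subset_rsupport hw' hband' (by rw [hexc0]; simp)
  have hφexc : ∀ t, φ ∉ (c' t).exc := fun t h => hexc t φ h (by rw [hr']; exact hrφ₁ t)
  -- (4) the letters: σ-diagonal weights of the twin at time `0` on letters `x, y, v ≠ φ`
  obtain ⟨π₀, hπ₀⟩ := hperm 0
  obtain ⟨a, a', u, h1, h2, h3, hra⟩ := hσtail (kₑ + 0) (by omega)
  obtain ⟨x, y, v, hxy, hxv, hyv, hσ0⟩ := sigma_mapDomain_perm h1 h2 h3 π₀ hra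
  have hr'0 : (c' 0).r = Finsupp.single x n + Finsupp.single y n + Finsupp.single v n := by rw [hr', hπ₀, hσ0]
  have hφ0 : (c' 0).r φ = 0 := by rw [hr']; exact hrφ₁ 0
  have hxz : x ≠ φ := fun h => by
    have := congrArg (fun r : Fin 4 →₀ ℕ => r x) hr'0
    simp only [Finsupp.add_apply, Finsupp.single_eq_same, Finsupp.single_eq_of_ne hxy, Finsupp.single_eq_of_ne hxv] at this
    rw [h, hφ0] at this; omega
  have hyz : y ≠ φ := fun h => by
    have := congrArg (fun r : Fin 4 →₀ ℕ => r y) hr'0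
    simp only [Finsupp.add_apply, Finsupp.single_eq_same, Finsupp.single_eq_of_ne hxy.symm, Finsupp.single_eq_of_ne hyv] at this
    rw [h, hφ0] at this; omega
  have hvz : v ≠ φ := fun h => by
    have := congrArg (fun r : Fin 4 →₀ ℕ => r v) hr'0
    simp only [Finsupp.add_apply, Finsupp.single_eq_same, Finsupp.single_eq_of_ne hxv.symm, Finsupp.single_eq_of_ne hyv.symm] at this
    rw [h, hφ0] at this; omega
  have hσtail' : ∀ t, ∃ x' y' v' : Fin 4, x' ≠ y' ∧ x' ≠ v' ∧ y' ≠ v' ∧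
      (c' t).r = Finsupp.single x' n + Finsupp.single y' n + Finsupp.single v' n := fun t => by
    obtain ⟨π, hπ⟩ := hperm t
    obtain ⟨a₁, a₁', u₁, h1, h2, h3, hr⟩ := hσtail (kₑ + t) (by omega)
    obtain ⟨x', y', v', h1', h2', h3', hσ'⟩ := sigma_mapDomain_perm h1 h2 h3 π hr
    exact ⟨x', y', v', h1', h2', h3', by rw [hr', hπ, hσ']⟩
  have hletters := sigma_diag_of_chain p hn hxy hxv hxz hyv hyz hvz hw' hjφ hr'0 hσtail' ho'
  -- (5) a satellite (letter-change) time `t₀ ≥ 1`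
  obtain ⟨t₀, ht₀, hsat⟩ := (FreeTail.satelliteRecurrenceAt_iff_noIsolatedFreeTailAt p p).mpr
    (FreeTailProof.noIsolatedFreeTailAt_self p) K c' j₁ b₁ hw' hiso' 1
  -- (6) the power-cone form at `t₀`, carried by `φ`
  obtain ⟨ℓ₀, a₀, -, hℓ₀V, hform⟩ := chain_resForm_eq_C_mul_pow p hc' hfloor' hdp hshade' he3' (Nat.zero_le t₀)
  have ha₀ : a₀ ≠ 0 := by
    intro h
    obtain ⟨o, ho, -⟩ := hband' t₀
    apply resForm_ne_zero ho (hdiv' t₀)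
    rw [hform, h, C_0, zero_mul]
  have hℓ₀φ : ℓ₀ φ ≠ 0 := by
    intro h
    have hmem : (Pi.single φ (1 : K) : Fin 4 → K) ∈ resVertex (c' t₀) := by
      rw [hℓ₀V, dotProduct_single, mul_one, h]
    have hzero := hker t₀ _ (by rw [← hresV']; exact hmem) fun i hi => by
      rw [Finset.mem_erase] at hi
      exact Pi.single_eq_of_ne hi.1 _
    have := congrFun hzero φ
    rw [Pi.single_eq_same, Pi.zero_apply] at this
    exact one_ne_zero this
  -- (7) shift by `t₀` and close with the diagonal composition
  have hclean : deletePthPowers p (c' t₀).F = (c' t₀).F := by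
    obtain ⟨t, rfl⟩ : ∃ t, t₀ = t + 1 := ⟨t₀ - 1, by omega⟩
    rw [hstep' t]
    exact CentreBlowup.deletePthPowers_step p Finset.univ (j₁ t) (b₁ t) (c' t)
  have hwit'' : FreeTail.IsWitnessedChain p (fun k => c' (t₀ + k)) (fun k => j₁ (t₀ + k)) fun k => b₁ (t₀ + k) :=
    fun k => hw' (t₀ + k)
  exact no_threeLetter_powerCone_tail_diag_sigma p hσ hn hd2 hxy hxv hxz hyv hyz hvz hwit'' hclean (fun k => hjφ (t₀ + k))
    (hφexc t₀) (hletters (t₀ + 0)) (fun k => hσtail' (t₀ + k)) (fun k => ho' (t₀ + k)) (hdiv' (t₀ + 0))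
    (fun k => he3' (t₀ + k) (Nat.zero_le _)) (fun k => hiso' (t₀ + k)) ha₀ hℓ₀φ hform
    (by simpa [Nat.add_zero] using hsat.1.symm)

/-! ## §3 Every T-sector σ = (n, n) + w with `w ≥ 1` from the raw chain -/

/-- **NO T-SECTOR POWER-CONE TAIL WITH σ-WEIGHTS (n, n) + w, ANY `w ≥ 1` — every prime** (one citation point for the lane's ledger): the
class-(i) RAW link `no_powerCone_tail_classI_sigma_raw` (p723209, `w ≠ n`: res-dim4-p-7 g6's two-slot game behind it) and the diagonal RAW link
`no_powerCone_tail_diag_sigma_raw` (`w = n`: res-dim4-p-5 g6's drift theorem behind it), by cases on `w = n`.  `w = 0` (two free letters,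
res-dim4-typ-1's class (iii) port) is NOT covered. [OURS · two-line case split] [cite: CossartJannsenSaito2020, Thm. 3.14] -/
theorem no_powerCone_tail_sigma_raw (p : ℕ) [Fact p.Prime] [CharP K p] {n w d : ℕ} (hσ : n + w + d = p) (hn : 0 < n) (hw : 0 < w)
    (hd2 : 2 ≤ d) {c : ℕ → State K} {j : ℕ → Fin 4} {b : ℕ → Fin 4 → K}
    (hc : ∀ k, IsIsolated p (c k).F ∧ Step0 p (c k) (c (k + 1))) (hwit : FreeTail.IsWitnessedChain p c j b)
    (hr0 : ∀ e ∈ (c 0).F.support, (c 0).r ≤ e) (hfloor : ∀ k, ordZero (c k).F ≠ p) {k₀ : ℕ}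
    (hshade : ∀ k, k₀ ≤ k → (c k).shade = (d : ℕ∞)) (he3 : ∀ k, k₀ ≤ k → Module.finrank K (resVertex (c k)) = 3)
    (hσtail : ∀ k, k₀ ≤ k → ∃ x y v : Fin 4, x ≠ y ∧ x ≠ v ∧ y ≠ v ∧
      (c k).r = Finsupp.single x n + Finsupp.single y n + Finsupp.single v w)
    {ℓ : ℕ → Fin 4 → K} (hℓV : ∀ k, k₀ ≤ k → ∀ u, u ∈ resVertex (c k) ↔ dotProduct (ℓ k) u = 0)
    {kₑ : ℕ} (hke : k₀ + 1 ≤ kₑ) {φ : Fin 4} (hrφ : (c kₑ).r φ = 0) (hℓφ : ℓ kₑ φ ≠ 0) : False := by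
  by_cases hwn : w = n
  · subst hwn
    exact no_powerCone_tail_diag_sigma_raw p hσ hn hd2 hc hwit hr0 hfloor hshade he3 hσtail hℓV hke hrφ hℓφ
  · exact no_powerCone_tail_classI_sigma_raw p hσ hn hw hwn hd2 hc hwit hr0 hfloor hshade he3 hσtail hℓV hke hrφ hℓφ

end ResCone
end Summit.ResolutionOfSingularities.ResolutionOfSingularities.Theorems.PIDim4

end
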